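import Summits.ResolutionOfSingularities.ResolutionOfSingularities.Theorems.FrobeniusClosingPatchingRelPerfectChartStrictExceptional
import HarnessLib

/-!
# Crux `PatchingRelPerfect` (stmt-ResolutionOfSingularities-16161), chain w52 — rung toolkit:
# blowing up a CODIMENSION-TWO centre `(t, ℓ)` — the strict transform of `V(t)` on the `ℓ`-chart is
# `V(t)` itself (three-letter step, brick 2)

[OURS · L1 W5.2 · rung tool] Companion to `…ChartStrictExceptional.lean` (which shows that on the
`v_k`-chart `C` of `Bl_{(t, v)}` the strict transform `u' = t/v_k` of `V(t)` cuts out a DOMAIN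
`C/(u') ≅ (A/(t))[(c̄)/v̄_k]`).  When the centre has codimension two — `c = (t, ℓ)`, one `v` — the
target `(A/(t))[(ℓ̄)/ℓ̄]` is the blow-up algebra of a PRINCIPAL ideal at its generator, i.e. `A/(t)`
itself: blowing up a Cartier divisor of `V(t)` does not change it.  PROVED, arbitrary rings:

* `blowupAlgebra_eq_bot_of_le_span` — `R[I/b] = R` (the bottom subalgebra of `R[1/b]`) when `I ⊆ (b)`;
  `isRegularRing_blowupAlgebra_of_le_span`, `isDomain_…` — hence regular / a domain when `R` is and
  `b` is a non-zero-divisor;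
* `strictExc_exists_quot_equiv` — the isomorphism `C/(u') ≅ (A/(t))[(c̄)/v̄_k]` of brick 1 EXPOSED
  with its values on the classes of `φ r` (`↦ r̄`);
* `strictExc_isRegularRing_quot_pair` — **for the codimension-two centre `(t, ℓ)`: `C/(u')` is a
  REGULAR ring when `A/(t)` is** (`C` the `ℓ`-chart, `u' = t/ℓ`), the regularity input of the
  three-letter step `(c, ℓ) ↦ (c' = c/ℓ, ℓ, o)` for the hyperplane letter.

Arbitrary commutative rings; nothing here is a statement of the manuscript under review.

## References

* The Stacks Project, Tags 0804, 07Z3, 0BIQ. [StacksProject]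
* U. Görtz, T. Wedhorn, *Algebraic Geometry I*, 2nd ed. 2020, Prop. 13.96 (2), (13.19). [GortzWedhorn2020]
-/

-- `Summit.<Summit>.<Sub>.Theorems` with `Sub = Summit` (single-conjunct summit, D-0017)
set_option linter.dupNamespace false

noncomputable section

open CategoryTheory CategoryTheory.Limits AlgebraicGeometry Literature.AlgebraicGeometry.Resolution
open IsLocalRing

namespace Summit.ResolutionOfSingularities.ResolutionOfSingularities.Theorems

namespace ConeRung

universe u

/-! ## The blow-up algebra of (an ideal inside) a principal ideal at its generator -/

/-- **`R[I/b]` is the bottom subalgebra of `R[1/b]` when `I ⊆ (b)`**: every generator `x/b`,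
`x = r b`, is `r/1`. [cite: GortzWedhorn2020, (13.19) p. 415] -/
theorem blowupAlgebra_eq_bot_of_le_span {R : Type u} [CommRing R] (I : Ideal R) (b : R)
    (h : I ≤ Ideal.span {b}) : blowupAlgebra I b = ⊥ := by
  refine le_antisymm ?_ bot_le
  refine Algebra.adjoin_le ?_
  rintro _ ⟨x, hx, rfl⟩
  obtain ⟨r, hr⟩ := Ideal.mem_span_singleton'.mp (h hx)
  refine Algebra.mem_bot.mpr ⟨r, ?_⟩
  rw [← hr, map_mul, mul_assoc, IsLocalization.Away.mul_invSelf, mul_one]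

/-- Hence `R[I/b] ≅ R` is a regular ring when `R` is and `b` is a non-zero-divisor.
[cite: GortzWedhorn2020, (13.19) p. 415] -/
theorem isRegularRing_blowupAlgebra_of_le_span {R : Type u} [CommRing R] [IsRegularRing R]
    (I : Ideal R) (b : R) (hb : b ∈ nonZeroDivisors R) (h : I ≤ Ideal.span {b}) :
    IsRegularRing (blowupAlgebra I b) := by
  have hinj : Function.Injective (algebraMap R (Localization.Away b)) :=
    IsLocalization.injective (Localization.Away b) (Submonoid.powers_le.mpr hb)
  let e : (⊥ : Subalgebra R (Localization.Away b)) ≃ₐ[R] R := Algebra.botEquivOfInjective hinj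
  have e' : blowupAlgebra I b ≃+* R :=
    ((Subalgebra.equivOfEq _ _ (blowupAlgebra_eq_bot_of_le_span I b h)).trans e).toRingEquiv
  exact IsRegularRing.of_ringEquiv e'.symm

/-! ## The isomorphism of brick 1, exposed -/

section StrictExceptional

variable {A : Type u} [CommRing A] {m : ℕ} (t : A) (v : Fin m → A) (k : Fin m)

local notation3 "cc" => (Fin.cons t v : Fin (m + 1) → A)
local notation3 "II" => Ideal.span (Set.range (Fin.cons t v : Fin (m + 1) → A))
local notation3 "C" => chartRing cc (Fin.succ k)
local notation3 "ψ" => chartBase cc (Fin.succ k)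
local notation3 "w" => chartBase cc (Fin.succ k) (cc (Fin.succ k))
local notation3 "u'" => chartGen cc (Fin.succ k) 0
local notation3 "RR" => blowupAlgebra (Ideal.span (Set.range (Fin.cons t v : Fin (m + 1) → A)))
  ((Fin.cons t v : Fin (m + 1) → A) (Fin.succ k))
local notation3 "Φ" => reesChartEquiv (I := Ideal.span (Set.range (Fin.cons t v : Fin (m + 1) → A)))
  ((Fin.cons t v : Fin (m + 1) → A) (Fin.succ k))
  (Ideal.mem_span_range_self (f := (Fin.cons t v : Fin (m + 1) → A)) (x := Fin.succ k))

/-- **`C/(u') ≅ (A/(t))[(c̄)/v̄_k]`, with values**: the class of `φ r` goes to `r̄`.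
[cite: GortzWedhorn2020, Prop. 13.96 (2) and p. 416] [cite: StacksProject, Tag 0804] -/
theorem strictExc_exists_quot_equiv (hc : IsQuasiRegular cc) [IsDomain (A ⧸ II)] :
    ∃ e : (C ⧸ Ideal.span {u'}) ≃+*
      blowupAlgebra ((II).map (Ideal.Quotient.mk (Ideal.span {t})))
        (Ideal.Quotient.mk (Ideal.span {t}) (cc (Fin.succ k))),
      ∀ r : A, e (Ideal.Quotient.mk _ (ψ r)) =
        algebraMap (A ⧸ Ideal.span {t}) _ (Ideal.Quotient.mk (Ideal.span {t}) r) := by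
  have hmap : Ideal.span {Φ u'} = (Ideal.span {u'}).map (Φ : C →+* RR) := by
    rw [Ideal.map_span, Set.image_singleton]; rfl
  refine ⟨(Ideal.quotientEquiv (Ideal.span {u'}) (Ideal.span {Φ u'}) (Φ) hmap).trans
    (blowupAlgebra.quotientKerMapQuotientEquiv (II) (cc (Fin.succ k))
      (strictExc_factor t v k) (strictExc_prime_algebraMap t v k hc) (strictExc_not_dvd t v k hc)),
    fun r => ?_⟩
  rw [RingEquiv.trans_apply, Ideal.quotientEquiv_mk, strictExc_equiv_chartBase,
    blowupAlgebra.quotientKerMapQuotientEquiv_mk, blowupAlgebra.mapQuotient_algebraMap]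

end StrictExceptional

/-! ## Codimension two: the strict transform of `V(t)` is `V(t)` -/

section CodimTwo

variable {A : Type u} [CommRing A] (t ℓ : A)

local notation3 "cc" => (Fin.cons t (fun _ : Fin 1 => ℓ) : Fin 2 → A)
local notation3 "II" => Ideal.span (Set.range (Fin.cons t (fun _ : Fin 1 => ℓ) : Fin 2 → A))
local notation3 "C" => chartRing cc (Fin.succ 0)
local notation3 "u'" => chartGen cc (Fin.succ 0) 0

/-- `(t, ℓ)` maps into `(ℓ̄)` modulo `t`. [folklore] -/
theorem map_span_pair_le_span :
    (II).map (Ideal.Quotient.mk (Ideal.span {t})) ≤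
      Ideal.span {Ideal.Quotient.mk (Ideal.span {t}) (cc (Fin.succ 0))} := by
  rw [Ideal.map_le_iff_le_comap, Ideal.span_le]
  rintro _ ⟨i, rfl⟩
  rw [SetLike.mem_coe, Ideal.mem_comap]
  refine Fin.cases ?_ (fun _ => ?_) i
  · have h0 : Ideal.Quotient.mk (Ideal.span {t}) t = 0 :=
      Ideal.Quotient.eq_zero_iff_mem.mpr (Ideal.mem_span_singleton_self t)
    rw [Fin.cons_zero, h0]
    exact Ideal.zero_mem _
  · rw [Fin.cons_succ]
    exact Ideal.subset_span rfl

/-- **Codimension-two centre `(t, ℓ)`: on the `ℓ`-chart, `C/(u')` is a regular ring when `A/(t)` is**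
(`u' = t/ℓ`; `C/(u') ≅ (A/(t))[(ℓ̄)/ℓ̄] = A/(t)`). Hypotheses: `(t, ℓ)` quasi-regular with `A/(t, ℓ)`
and `A/(t)` domains, `ℓ ∉ (t)`. [cite: GortzWedhorn2020, Prop. 13.96 (2)] [cite: StacksProject, Tag 0804] -/
theorem strictExc_isRegularRing_quot_pair (hc : IsQuasiRegular cc) [IsDomain (A ⧸ II)]
    [IsDomain (A ⧸ Ideal.span {t})] [IsRegularRing (A ⧸ Ideal.span {t})]
    (hℓ : ℓ ∉ Ideal.span {t}) : IsRegularRing (C ⧸ Ideal.span {u'}) := by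
  obtain ⟨e, -⟩ := strictExc_exists_quot_equiv t (fun _ : Fin 1 => ℓ) 0 hc
  have hne : Ideal.Quotient.mk (Ideal.span {t}) (cc (Fin.succ 0)) ≠ 0 := by
    rw [Fin.cons_succ, Ne, Ideal.Quotient.eq_zero_iff_mem]
    exact hℓ
  haveI := isRegularRing_blowupAlgebra_of_le_span
    ((II).map (Ideal.Quotient.mk (Ideal.span {t}))) _
    (mem_nonZeroDivisors_of_ne_zero hne) (map_span_pair_le_span t ℓ)
  exact IsRegularRing.of_ringEquiv e.symm

end CodimTwo

end ConeRung

end Summit.ResolutionOfSingularities.ResolutionOfSingularities.Theorems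

end
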